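import Literature.MathematicalPhysics.QuantumLattice.GrassmannIntegrationByParts
import Literature.MathematicalPhysics.QuantumLattice.GrassmannPairLaplacians
import Mathlib.LinearAlgebra.Matrix.Determinant.Basic
import Mathlib.GroupTheory.Perm.Fin
import HarnessLib

/-!
# The determinant rule for the Gaussian expectation of paired monomials (`e^{Δ_C}` calculus)

Topic `Literature/MathematicalPhysics/QuantumLattice`; continuation of `GrassmannIntegrationByParts.lean`
(integration by parts `∫ dμ_C ψ(X) a = Σ_Y A(X,Y) ∫ dμ_C ∂_Y a` for the Gaussian expectation
`gaussExpect R C = constPart ∘ e^{Δ_C}` of an ARBITRARY covariance, Salmhofer 1999, §4.3) to all orders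
for PAIRED monomials `ψ(X̄₀)ψ(X₀) ψ(X̄₁)ψ(X₁) ⋯ ψ(X̄_{k-1})ψ(X_{k-1})` (`genPairProd`): if the two-point
function `A(X,Y) = ∫ dμ_C ψ(X)ψ(Y) = ½(C(Y,X) − C(X,Y))` (`contr C`) vanishes between the "barred" labels,
`A(X̄_i, X̄_j) = 0` — as for a charged covariance, which only contracts `ψ̄` with `ψ` — then

`∫ dμ_C ψ(X̄₀)ψ(X₀) ⋯ ψ(X̄_{k-1})ψ(X_{k-1}) = det [A(X̄_i, X_j)]_{i,j}`

(**`gaussExpect_genPairProd`**; Feldman–Knörrer–Trubowitz 2002, Prop. I.18 / Lemma B.1: the Pfaffian of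
Wick's rule reduces to a determinant when the `ψ̄ψ̄` contractions vanish; Salmhofer 1999, (4.31)/(B.30)).
The proof is the Laplace expansion along the first row: one integration by parts
(`sum_contr_smul_grassmannDeriv_genPairProd`: the pairing operator `Σ_Y A(X̄₀,Y) ∂_Y` deletes one `ψ(X_j)`
from the product, `genPairProdDel`), one anticommutation (`gen_mul_genPairProdDel`: the freed `ψ(X₀)` takes
the place of the deleted field), and the column cycle `Fin.cycleRange` of `Matrix.det_succ_row_zero`.
This is the input of the Gram–Hadamard bound for the loop lines of the single-scale tree expansion in
the Laplacian host.  Everything is proved; no named fact.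

## Sources

J. Feldman, H. Knörrer, E. Trubowitz, *Fermionic Functional Integrals and the Renormalization Group*
(CRM Monograph Series 16, AMS 2002), §I.2–I.3 and App. B (`FeldmanKnorrerTrubowitz2002`); M. Salmhofer,
*Renormalization: An Introduction* (Springer 1999), §4.2–4.3, App. B.5 (`Salmhofer1999`).
-/

noncomputable section

namespace Literature.MathematicalPhysics.QuantumLattice

open GrassmannAlgebra Matrix

variable (R : Type*) [CommRing R] {Γ : Type*}

/-! ### The two-point function and paired monomials -/

variable [Algebra ℚ R] in
/-- The **two-point function** (contraction) of the covariance `C`: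
`A(X,Y) = ½ (C(Y,X) − C(X,Y)) = ∫ dμ_C ψ(X)ψ(Y)` (`gaussExpect_gen_mul_gen`). [folklore] -/
def contr (C : Matrix Γ Γ R) : Matrix Γ Γ R :=
  Matrix.of fun X Y => ((1 / 2 : ℚ) • (1 : R)) * (C Y X - C X Y)

variable [Algebra ℚ R] in
/-- Unfolding `contr`. [folklore] -/
theorem contr_apply (C : Matrix Γ Γ R) (X Y : Γ) : contr R C X Y = ((1 / 2 : ℚ) • (1 : R)) * (C Y X - C X Y) := rfl

variable [Algebra ℚ R] in
/-- The two-point function is antisymmetric. [folklore] -/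
theorem contr_swap (C : Matrix Γ Γ R) (X Y : Γ) : contr R C Y X = -contr R C X Y := by
  rw [contr_apply, contr_apply, ← mul_neg, neg_sub]

/-- The index bookkeeping of the Laplace expansion: putting `X₀` at place `j` of the tail of `X` is
`X` read through the transposition `(0, j+1)`. [folklore] -/
theorem update_tail_apply {k : ℕ} (Xu : Fin (k + 1) → Γ) (j i : Fin k) :
    Function.update (Fin.tail Xu) j (Xu 0) i = Xu (Equiv.swap 0 j.succ i.succ) := by
  by_cases h : i = j
  · subst h
    rw [Function.update_self, Equiv.swap_apply_right]
  · rw [Function.update_of_ne h, Equiv.swap_apply_of_ne_of_ne (Fin.succ_ne_zero i) fun h' => h (Fin.succ_injective _ h')]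
    rfl

variable [DecidableEq Γ]

/-- The **paired monomial** `ψ(X̄₀)ψ(X₀) ψ(X̄₁)ψ(X₁) ⋯ ψ(X̄_{k-1})ψ(X_{k-1})` of two label tuples (the
"barred" labels `Xb` and the "unbarred" ones `Xu`), in this order. [folklore] -/
def genPairProd {k : ℕ} (Xb Xu : Fin k → Γ) : GrassmannAlgebra R Γ :=
  (List.ofFn fun i => gen R (Xb i) * gen R (Xu i)).prod

/-- The paired monomial with the unbarred field of the `j`-th pair **deleted**:
`⋯ (ψ(X̄_{j-1})ψ(X_{j-1})) ψ(X̄_j) (ψ(X̄_{j+1})ψ(X_{j+1})) ⋯`. [folklore] -/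
def genPairProdDel {k : ℕ} (Xb Xu : Fin k → Γ) (j : Fin k) : GrassmannAlgebra R Γ :=
  (List.ofFn fun i => if i = j then gen R (Xb i) else gen R (Xb i) * gen R (Xu i)).prod

/-- The empty paired monomial is `1`. [folklore] -/
@[simp] theorem genPairProd_zero (Xb Xu : Fin 0 → Γ) : genPairProd R Xb Xu = 1 := by
  simp [genPairProd]

/-- Peeling the first pair. [folklore] -/
theorem genPairProd_succ {k : ℕ} (Xb Xu : Fin (k + 1) → Γ) :
    genPairProd R Xb Xu = gen R (Xb 0) * gen R (Xu 0) * genPairProd R (Fin.tail Xb) (Fin.tail Xu) := by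
  rw [genPairProd, List.ofFn_succ, List.prod_cons]
  rfl

/-- Deleting from the first pair leaves its barred field in front of the tail. [folklore] -/
theorem genPairProdDel_zero {k : ℕ} (Xb Xu : Fin (k + 1) → Γ) :
    genPairProdDel R Xb Xu 0 = gen R (Xb 0) * genPairProd R (Fin.tail Xb) (Fin.tail Xu) := by
  rw [genPairProdDel, List.ofFn_succ, List.prod_cons, if_pos rfl, genPairProd]
  simp only [Fin.succ_ne_zero, if_false, Fin.tail]

/-- Deleting from a later pair keeps the first pair in front. [folklore] -/
theorem genPairProdDel_succ {k : ℕ} (Xb Xu : Fin (k + 1) → Γ) (j : Fin k) :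
    genPairProdDel R Xb Xu j.succ = gen R (Xb 0) * gen R (Xu 0) * genPairProdDel R (Fin.tail Xb) (Fin.tail Xu) j := by
  rw [genPairProdDel, List.ofFn_succ, List.prod_cons, if_neg (Fin.succ_ne_zero j).symm, genPairProdDel]
  simp only [Fin.succ_inj, Fin.tail]

/-- A product of two generators is even. [folklore] -/
theorem gen_mul_gen_mem_evenOdd_zero (X Y : Γ) : gen R X * gen R Y ∈ evenOdd R (0 : ZMod 2) :=
  CliffordAlgebra.ι_mul_ι_mem_evenOdd_zero _ _ _

/-- Paired monomials are even. [folklore] -/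
theorem genPairProd_mem_evenOdd_zero : ∀ {k : ℕ} (Xb Xu : Fin k → Γ), genPairProd R Xb Xu ∈ evenOdd R (0 : ZMod 2)
  | 0, Xb, Xu => by rw [genPairProd_zero]; exact one_mem_evenOdd_zero R
  | _ + 1, Xb, Xu => by
    rw [genPairProd_succ]
    exact mul_mem_evenOdd_zero R (gen_mul_gen_mem_evenOdd_zero R _ _) (genPairProd_mem_evenOdd_zero _ _)

/-- **The freed field takes the place of the deleted one**:
`ψ(W) · genPairProdDel Xb Xu j = − genPairProd Xb (Xu with X_j ↦ W)` (it commutes with the even pairs in front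
of position `j` and anticommutes with `ψ(X̄_j)`). [folklore] -/
theorem gen_mul_genPairProdDel : ∀ {k : ℕ} (Xb Xu : Fin k → Γ) (j : Fin k) (W : Γ),
    gen R W * genPairProdDel R Xb Xu j = -genPairProd R Xb (Function.update Xu j W)
  | 0, _, _, j, _ => j.elim0
  | k + 1, Xb, Xu, j, W => by
    induction j using Fin.cases with
    | zero =>
      rw [genPairProdDel_zero, ← mul_assoc, gen_mul_gen, neg_mul, genPairProd_succ, Function.update_self,
        Fin.tail_update_zero]
    | succ j =>
      rw [genPairProdDel_succ, ← mul_assoc, ← (commute_of_mem_evenOdd_zero R (gen_mul_gen_mem_evenOdd_zero R _ _) _).eq,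
        mul_assoc, gen_mul_genPairProdDel _ _ j W, mul_neg, genPairProd_succ R Xb (Function.update Xu j.succ W),
        Function.update_of_ne (Fin.succ_ne_zero j).symm, Fin.tail_update_succ]

variable [Fintype Γ] [Algebra ℚ R]

omit [DecidableEq Γ] in
/-- Linearity of `∫ dμ_C a · (Σ_i c_i f_i)`. [folklore] -/
theorem gaussExpect_mul_sum_smul (C : Matrix Γ Γ R) (a : GrassmannAlgebra R Γ) {α : Type*} (s : Finset α)
    (c : α → R) (f : α → GrassmannAlgebra R Γ) :
    gaussExpect R C (a * ∑ i ∈ s, c i • f i) = ∑ i ∈ s, c i * gaussExpect R C (a * f i) := by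
  rw [Finset.mul_sum, map_sum]
  exact Finset.sum_congr rfl fun i _ => by rw [mul_smul_comm, map_smul, smul_eq_mul]

/-- **The pairing operator deletes one unbarred field**: if `A(X, X̄_i) = 0` for all `i`, then
`Σ_Y A(X,Y) ∂_Y (genPairProd Xb Xu) = − Σ_j A(X, X_j) · genPairProdDel Xb Xu j`. [folklore] -/
theorem sum_contr_smul_grassmannDeriv_genPairProd (C : Matrix Γ Γ R) (X : Γ) :
    ∀ {k : ℕ} (Xb Xu : Fin k → Γ), (∀ i, contr R C X (Xb i) = 0) →
      ∑ Y, contr R C X Y • grassmannDeriv R Y (genPairProd R Xb Xu) =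
        -∑ j, contr R C X (Xu j) • genPairProdDel R Xb Xu j
  | 0, Xb, Xu, _ => by simp
  | k + 1, Xb, Xu, hX => by
    have ih := sum_contr_smul_grassmannDeriv_genPairProd C X (Fin.tail Xb) (Fin.tail Xu) fun i => hX i.succ
    -- the graded Leibniz rule over the (even) first pair
    have hder : ∀ Y, grassmannDeriv R Y (genPairProd R Xb Xu) =
        ((if Y = Xb 0 then gen R (Xu 0) else 0) - (if Y = Xu 0 then gen R (Xb 0) else 0)) *
            genPairProd R (Fin.tail Xb) (Fin.tail Xu) +
          gen R (Xb 0) * gen R (Xu 0) * grassmannDeriv R Y (genPairProd R (Fin.tail Xb) (Fin.tail Xu)) := fun Y => by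
      rw [genPairProd_succ, grassmannDeriv_mul_of_mem_evenOdd_zero R Y (gen_mul_gen_mem_evenOdd_zero R _ _),
        grassmannDeriv_gen_mul_gen]
    have hA : ∑ Y, contr R C X Y • ((if Y = Xb 0 then gen R (Xu 0) else 0) * genPairProd R (Fin.tail Xb) (Fin.tail Xu)) = 0 := by
      simp only [ite_mul, zero_mul, smul_ite, smul_zero, Finset.sum_ite_eq', Finset.mem_univ, if_true, hX 0, zero_smul]
    have hB : ∑ Y, contr R C X Y • ((if Y = Xu 0 then gen R (Xb 0) else 0) * genPairProd R (Fin.tail Xb) (Fin.tail Xu)) =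
        contr R C X (Xu 0) • genPairProdDel R Xb Xu 0 := by
      simp only [ite_mul, zero_mul, smul_ite, smul_zero, Finset.sum_ite_eq', Finset.mem_univ, if_true, genPairProdDel_zero]
    have hC : ∑ Y, contr R C X Y • (gen R (Xb 0) * gen R (Xu 0) * grassmannDeriv R Y (genPairProd R (Fin.tail Xb) (Fin.tail Xu))) =
        -∑ j : Fin k, contr R C X (Xu j.succ) • genPairProdDel R Xb Xu j.succ := by
      simp_rw [← mul_smul_comm]
      rw [← Finset.mul_sum, ih, mul_neg, Finset.mul_sum]
      congr 1
      refine Finset.sum_congr rfl fun j _ => ?_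
      rw [mul_smul_comm, genPairProdDel_succ]
      rfl
    calc ∑ Y, contr R C X Y • grassmannDeriv R Y (genPairProd R Xb Xu)
        = ∑ Y, (contr R C X Y • ((if Y = Xb 0 then gen R (Xu 0) else 0) * genPairProd R (Fin.tail Xb) (Fin.tail Xu)) -
            contr R C X Y • ((if Y = Xu 0 then gen R (Xb 0) else 0) * genPairProd R (Fin.tail Xb) (Fin.tail Xu)) +
            contr R C X Y • (gen R (Xb 0) * gen R (Xu 0) * grassmannDeriv R Y (genPairProd R (Fin.tail Xb) (Fin.tail Xu)))) :=
          Finset.sum_congr rfl fun Y _ => by rw [hder, smul_add, sub_mul, smul_sub]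
      _ = 0 - contr R C X (Xu 0) • genPairProdDel R Xb Xu 0 + -∑ j : Fin k, contr R C X (Xu j.succ) • genPairProdDel R Xb Xu j.succ := by
          rw [Finset.sum_add_distrib, Finset.sum_sub_distrib, hA, hB, hC]
      _ = -∑ j, contr R C X (Xu j) • genPairProdDel R Xb Xu j := by
          rw [Fin.sum_univ_succ, neg_add, zero_sub]

/-- **The determinant rule for paired monomials** (Wick's rule when the barred labels do not contract
among themselves, e.g. for a charged covariance): if `A(X̄_i, X̄_j) = 0` for all `i, j`, then
`∫ dμ_C ψ(X̄₀)ψ(X₀) ⋯ ψ(X̄_{k-1})ψ(X_{k-1}) = det [A(X̄_i, X_j)]_{i,j}`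
(Feldman–Knörrer–Trubowitz 2002, Prop. I.18 / Lemma B.1; Salmhofer 1999, (4.31)).
[cite: FeldmanKnorrerTrubowitz2002, §I.3 Prop. I.18] -/
theorem gaussExpect_genPairProd (C : Matrix Γ Γ R) :
    ∀ {k : ℕ} (Xb Xu : Fin k → Γ), (∀ i j, contr R C (Xb i) (Xb j) = 0) →
      gaussExpect R C (genPairProd R Xb Xu) = (Matrix.of fun i j => contr R C (Xb i) (Xu j)).det
  | 0, Xb, Xu, _ => by rw [genPairProd_zero, gaussExpect_one, det_isEmpty]
  | k + 1, Xb, Xu, hb => by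
    have hb' : ∀ i j, contr R C (Fin.tail Xb i) (Fin.tail Xb j) = 0 := fun i j => hb i.succ j.succ
    -- integration by parts on `ψ(X̄₀)`, then the graded Leibniz rule past `ψ(X₀)`
    have h1 : gaussExpect R C (genPairProd R Xb Xu) =
        contr R C (Xb 0) (Xu 0) * gaussExpect R C (genPairProd R (Fin.tail Xb) (Fin.tail Xu)) -
          gaussExpect R C (gen R (Xu 0) *
            ∑ Y, contr R C (Xb 0) Y • grassmannDeriv R Y (genPairProd R (Fin.tail Xb) (Fin.tail Xu))) := by
      rw [gaussExpect_mul_sum_smul, genPairProd_succ, mul_assoc, gaussExpect_gen_mul]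
      simp only [← contr_apply]
      simp only [grassmannDeriv_gen_mul, map_sub, mul_sub, Finset.sum_sub_distrib, apply_ite (gaussExpect R C), map_zero,
        mul_ite, mul_zero, Finset.sum_ite_eq', Finset.mem_univ, if_true]
    -- the minors: the updated matrix is the minor of the Laplace expansion with its columns cycled
    have hdet : ∀ j : Fin k,
        (Matrix.of fun i i' => contr R C (Fin.tail Xb i) (Function.update (Fin.tail Xu) j (Xu 0) i')).det =
          (-1 : R) ^ (j : ℕ) * ((Matrix.of fun i j => contr R C (Xb i) (Xu j)).submatrix Fin.succ j.succ.succAbove).det := by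
      intro j
      have hperm : (Matrix.of fun i i' => contr R C (Fin.tail Xb i) (Function.update (Fin.tail Xu) j (Xu 0) i')) =
          ((Matrix.of fun i j => contr R C (Xb i) (Xu j)).submatrix Fin.succ j.succ.succAbove).submatrix id (Fin.cycleRange j) := by
        ext i i'
        simp only [Matrix.of_apply, Matrix.submatrix_apply, id_eq, Fin.succAbove_cycleRange, update_tail_apply, Fin.tail]
      rw [hperm, det_permute', Fin.sign_cycleRange]
      simp
    rw [h1, sum_contr_smul_grassmannDeriv_genPairProd R C (Xb 0) (Fin.tail Xb) (Fin.tail Xu) (fun i => hb 0 i.succ),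
      mul_neg, map_neg, sub_neg_eq_add, gaussExpect_mul_sum_smul,
      gaussExpect_genPairProd C (Fin.tail Xb) (Fin.tail Xu) hb', det_succ_row_zero, Fin.sum_univ_succ]
    congr 1
    · rw [Fin.val_zero, pow_zero, one_mul, Fin.succAbove_zero, Matrix.of_apply]
      rfl
    · refine Finset.sum_congr rfl fun j _ => ?_
      rw [gen_mul_genPairProdDel, map_neg, gaussExpect_genPairProd C (Fin.tail Xb) _ hb', hdet j, Fin.val_succ, pow_succ,
        Matrix.of_apply]
      simp only [Fin.tail]
      ring

end Literature.MathematicalPhysics.QuantumLattice
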